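import Summits.Ventures.Crystal3D.Theses.StickyWulffConstant
import Summits.Ventures.Crystal3D.Theorems.StickyWulffConstantLiminfAssemblySplit
import Summits.Ventures.Crystal3D.Theorems.StickyWulffConstantGenericWallFloorResidualCoverageDefs
import HarnessLib

/-!
# `LiminfAssembly` from the LAW-v5 items (cf-p1 g30; decisions (lx), (lxix), (lxxii); route rev 11, commit 05ce42b4fe51)

TURNKEY landing file (sorry-free, farm rc 0): land verbatim as
`Summits/Ventures/Crystal3D/Theorems/StickyWulffConstantLiminfAssemblyOfV5.lean` with `--supports stmt-Ventures-19146`.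

* `liminfAssembly_of_v5 : GenericWallFloorV5 → CoaxialWallLaw → PolycrystalWulffBoundV5 → TextureLiminfV5 → LiminfAssembly`
  — the v4 glue proof (`liminfAssemblySplit_proof`, p-landed) verbatim: the argument is constant-agnostic, so the
  parent `LiminfAssembly` (stmt-Ventures-19146) closes from the v5 family
  {stmt-Ventures-23910 `GenericWallFloorV5` (c₀ = 13/25), stmt-Ventures-19481 `CoaxialWallLaw` (c₁ = ½),
   stmt-Ventures-23911 `PolycrystalWulffBoundV5`, stmt-Ventures-23912 `TextureLiminfV5`}
  exactly as it closes from the v4 children (c₀ = 1, which stay open as the strong forms).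
* `genericWallFloorV5_iff_atCharge` (`Iff.rfl`): the item IS «∀ non-co-axial pairs, `GenericWallFloorAtCharge (13/25)`».
* `genericWallFloorV5_of_coverage : P5Exhaustion → StarPairFar → ResidualOneSidedCoverage (13/25) → GenericWallFloorV5`
  — lane G's closer (p681668 `genericWallFloorAtCharge_all_of_coverage`) at c₀ = 13/25, BY NAME.
-/

noncomputable section

namespace Summit.Ventures.Crystal3D.Theorems

open Summit.Ventures.Crystal3D.Theses.StickyWulffConstant

open scoped BigOperators Topology Manifold Classical MeasureTheory ProbabilityTheory Matrix InnerProductSpace ComplexConjugate ContinuousMap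
open Filter Set Function TopologicalSpace MeasureTheory
open Summit.Ventures.Crystal3D

/-- **`LiminfAssembly` from the law-v5 family** `{GenericWallFloorV5 (c₀ = 13/25), CoaxialWallLaw (c₁ = ½),
PolycrystalWulffBoundV5, TextureLiminfV5}` — the v4 glue proof `liminfAssemblySplit_proof` verbatim (the argument is
constant-agnostic). -/
theorem liminfAssembly_of_v5 :
    GenericWallFloorV5 → CoaxialWallLaw → PolycrystalWulffBoundV5 → TextureLiminfV5 → LiminfAssembly := by
  intro hG hF hP hT hNRG hSL ε hε
  by_contra H
  push Not at H
  choose Nf hNf x hx hlt using H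
  have hκpos : (0 : ℝ) < 6 * (2 : ℝ) ^ ((1 : ℝ) / 3) := by positivity
  have htend : Tendsto Nf atTop atTop := tendsto_atTop_mono hNf tendsto_id
  have hbd : ∀ k, 6 * (Nf k : ℝ) - (numContacts (x k) : ℝ) ≤
      6 * (2 : ℝ) ^ ((1 : ℝ) / 3) * (Nf k : ℝ) ^ ((2 : ℝ) / 3) := by
    intro k
    refine (hlt k).le.trans ?_
    exact mul_le_mul_of_nonneg_right (by linarith) (Real.rpow_nonneg (Nat.cast_nonneg _) _)
  set δ : ℝ := min (ε / (4 * (6 * (2 : ℝ) ^ ((1 : ℝ) / 3)))) (1 / 2) with hδdef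
  have hδ : 0 < δ := lt_min (by positivity) (by norm_num)
  have hδhalf : δ ≤ 1 / 2 := min_le_right _ _
  have hκδ : 6 * (2 : ℝ) ^ ((1 : ℝ) / 3) * δ ≤ ε / 4 := by
    calc 6 * (2 : ℝ) ^ ((1 : ℝ) / 3) * δ
        ≤ 6 * (2 : ℝ) ^ ((1 : ℝ) / 3) * (ε / (4 * (6 * (2 : ℝ) ^ ((1 : ℝ) / 3)))) :=
          mul_le_mul_of_nonneg_left (min_le_left _ _) hκpos.le
      _ = ε / 4 := by field_simp
  have hη : (0 : ℝ) < ε / 4 := by positivity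
  obtain ⟨φ, hφ, p, n, G, A, c, m, hTex, hmass, hev⟩ :=
    hT hG hF hNRG hSL (6 * (2 : ℝ) ^ ((1 : ℝ) / 3)) δ (ε / 4) hδ hη Nf x hx htend hbd
  have hlow := Summit.Ventures.Crystal3D.Theorems.kappa_mul_one_sub_le_sum_energy (6 * (2 : ℝ) ^ ((1 : ℝ) / 3)) δ hκpos.le hδ.le
    hδhalf _ _ (fun i => hP (n i) (G i) (A i) (c i) (m i) (hTex i)) hmass
    (fun i => ENNReal.toReal_nonneg)
  obtain ⟨k, hk1, hk⟩ := ((eventually_ge_atTop 1).and hev).exists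
  have hNk : (1 : ℝ) ≤ (Nf (φ k) : ℝ) := by
    have : 1 ≤ Nf (φ k) := hk1.trans ((hφ.id_le k).trans (hNf (φ k)))
    exact_mod_cast this
  have ht : (0 : ℝ) < (Nf (φ k) : ℝ) ^ ((2 : ℝ) / 3) := Real.rpow_pos_of_pos (by linarith) _
  have hup : (6 * (Nf (φ k) : ℝ) - (numContacts (x (φ k)) : ℝ)) / (Nf (φ k) : ℝ) ^ ((2 : ℝ) / 3)
      < 6 * (2 : ℝ) ^ ((1 : ℝ) / 3) - ε := by
    rw [div_lt_iff₀ ht]; exact hlt (φ k)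
  linarith


/-- `GenericWallFloorV5` IS «every non-co-axial pair satisfies `GenericWallFloorAtCharge (13/25)`» (definitional). -/
theorem genericWallFloorV5_iff_atCharge :
    GenericWallFloorV5 ↔
      ∀ (A₁ : EuclideanSpace ℝ (Fin 3) ≃ₗᵢ[ℝ] EuclideanSpace ℝ (Fin 3)) (t₁ : EuclideanSpace ℝ (Fin 3))
        (A₂ : EuclideanSpace ℝ (Fin 3) ≃ₗᵢ[ℝ] EuclideanSpace ℝ (Fin 3)) (t₂ : EuclideanSpace ℝ (Fin 3)),
        ¬ (∃ (L : EuclideanSpace ℝ (Fin 3) ≃ₗᵢ[ℝ] EuclideanSpace ℝ (Fin 3)) (s₁ s₂ : EuclideanSpace ℝ (Fin 3))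
            (σ σ' : ℤ → ℤ), Literature.MathematicalPhysics.StatisticalMechanics.IsHaggSeq σ ∧ Literature.MathematicalPhysics.StatisticalMechanics.IsHaggSeq σ' ∧
            (fun p => A₁ p + t₁) '' Literature.MathematicalPhysics.StatisticalMechanics.fccStacking 1 (Real.sqrt (2 / 3)) ⊆
              (fun p => L p + s₁) '' Literature.MathematicalPhysics.StatisticalMechanics.barlowStacking 1 (Real.sqrt (2 / 3)) σ ∧
            (fun p => A₂ p + t₂) '' Literature.MathematicalPhysics.StatisticalMechanics.fccStacking 1 (Real.sqrt (2 / 3)) ⊆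
              (fun p => L p + s₂) '' Literature.MathematicalPhysics.StatisticalMechanics.barlowStacking 1 (Real.sqrt (2 / 3)) σ') →
        Summit.Ventures.Crystal3D.Theorems.GenericWallFloorAtCharge (13 / 25) A₁ t₁ A₂ t₂ :=
  Iff.rfl

/-- **Lane G closes `GenericWallFloorV5` modulo its three named inputs** (p681668's closer at `c₀ = 13/25`). -/
theorem genericWallFloorV5_of_coverage (hE1 : Summit.Ventures.Crystal3D.Theorems.P5Exhaustion)
    (hSP : Summit.Ventures.Crystal3D.Theorems.StarPairFar)
    (hcov : Summit.Ventures.Crystal3D.Theorems.ResidualOneSidedCoverage (13 / 25)) : GenericWallFloorV5 := by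
  rw [genericWallFloorV5_iff_atCharge]
  intro A₁ t₁ A₂ t₂ hnc
  exact Summit.Ventures.Crystal3D.Theorems.genericWallFloorAtCharge_all_of_coverage hE1 hSP
    (by norm_num) (by norm_num) hcov A₁ t₁ A₂ t₂ hnc

end Summit.Ventures.Crystal3D.Theorems

end
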